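import Summits.Schanuel.Schanuel.Theorems.RootDecomp1KKummerClosure02

/-!
# RootDecomp1KKummerClosure («KUMMER CLOSURE», lens 6 gen 12/13 = 1K ROUND 9) — continuation (RootDecomp1KKummerClosure03): §K5 (first half) engine helpers + the two self-contained halves engine_lower (FTT lower bound on the eliminant) and engine_upper (product upper bound at a super-approximant)

Part of the six-file split (400-line rule) of lens 6's node «KUMMER CLOSURE» = HOME/decomp-schanuel-lens-6/g13/addendum/KummerClosure.lean (v2, sha256 6dd432d1…, 1650 l;
= g12 v1 6d5e0790… with the engine re-cut into engine_lower / engine_upper at the census's request, every statement byte-identical; 1K ROUND 9 THEOREM ROUND on the critic's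
round-9 ACCEPTED-NEXT (i‴) «general Kummer closure with the UNIFORM degree bound»; `--supports stmt-Schanuel-33363`). Shared namespace
`Summit.Schanuel.Schanuel.Theorems.RootDecomp1KKummerClosure`; the node docstring is in part 01; K4's one-line copies of tree-private lemmas are private here.
Facts enter as hypotheses only (hNW : NesterenkoWaldschmidt1996_thm_1, hlm : Literature.Uncategorized.W78LogMeasure). Sorry-free; standard axioms. Nothing here proves Schanuel; rung 0.
-/

open Polynomial Complex IntermediateField
open Summit.Schanuel.Schanuel.Theorems.RootDecomp1KHyper
open Summit.Schanuel.Schanuel.Theorems.RootDecomp1KHyper.HyperCell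
open Summit.Schanuel.Schanuel.Theorems.RootDecomp1KRadical

noncomputable section

namespace Summit.Schanuel.Schanuel.Theorems.RootDecomp1KKummerClosure

/-- `Real.log x ≤ x`. -/
private theorem log_le_self_of_pos' {x : ℝ} (hx : 0 < x) : Real.log x ≤ x := by
  have := Real.log_le_sub_one_of_pos hx; linarith

/-- `x ≤ Real.exp x`. -/
private theorem self_le_exp' (x : ℝ) : x ≤ Real.exp x := by linarith [Real.add_one_le_exp x]

/-- `Real.log 32 ≤ 5`. -/
private theorem log_thirtytwo_le_five' : Real.log 32 ≤ 5 := by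
  have h2 : Real.log 2 < 0.6931471808 := Real.log_two_lt_d9
  rw [show (32 : ℝ) = 2 ^ 5 by norm_num, Real.log_pow]; push_cast; linarith

/-! ## K5. THE KUMMER ENGINE: no integer relation between `ρ, λ, e^{λρ}` (`e^λ = α ∈ ℚ̄^× ∖ μ_∞`,
`λ` of finite transcendence type, `ρ > 0` hyper-Liouville)

gen 13 re-cut (census NOTE 2026-08-30T19:37:09Z, 400-line file rule): the engine is assembled from two
self-contained halves — (L) `engine_lower` (the finite-type measure of `λ` applied to the eliminant) and
(U) `engine_upper` (the product over the roots of the norm polynomial) — plus two small helpers; the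
statements of `logCell_aeval_ne_zero` / `algebraicIndependent_logCell` are UNCHANGED. -/

/-- NON-VANISHING of the conjugate factors `F(p/q, λ, b) = Σ_k G_k(λ) b^k` from a DEGREE LOWER BOUND at
`b`: if every non-zero integer polynomial vanishing at `b` has degree `≥ c q > N ≥ deg G_k`, then
`G_{k₀}(b) = 0` forces `G_{k₀} = 0`, i.e. `d(p/q) = 0`, excluded by the denominator bound. -/
theorem conjFactor_torG_ne_zero_of_degree (P : MvPolynomial (Fin 3) ℤ) (D : ℕ) {K N : ℕ}
    (hD : ∀ s ∈ P.support, s 0 ≤ D) (hN : ∀ s ∈ P.support, s 2 ≤ N) {s₀ : Fin 3 →₀ ℕ}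
    (hs₀ : s₀ ∈ P.support) (hs₀K : s₀ 1 ≤ K) (r : ℚ)
    (hq1 : denBound (torD P (s₀ 1) (s₀ 2)) ≤ r.den) {c : ℝ} (hcq : (N : ℝ) < c * r.den) {b : ℂ}
    (hb : ∀ g : ℤ[X], g ≠ 0 → aeval b g = 0 → c * r.den ≤ (g.natDegree : ℝ)) :
    conjFactor (torG P D r.num r.den K) b ≠ 0 := by
  have hq0 : r.den ≠ 0 := r.den_nz
  intro h0
  set k : Fin (K + 1) := ⟨s₀ 1, Nat.lt_succ_of_le hs₀K⟩ with hk
  have hcoef : aeval b (torG P D r.num r.den K k) = 0 := by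
    have := coeff_conjFactor (torG P D r.num r.den K) b k
    rw [h0, coeff_zero] at this
    exact this.symm
  by_cases hG : torG P D r.num r.den K k = 0
  · have h1 := coeff_torG_eq_torD D r.num r.den hD hq0 k (s₀ 2)
    rw [hG, coeff_zero, Int.cast_zero, eq_comm, mul_eq_zero] at h1
    have hqQ : (r.den : ℚ) ^ D ≠ 0 := pow_ne_zero _ (by exact_mod_cast hq0)
    have h2 : aeval ((r.num : ℚ) / r.den) (torD P (s₀ 1) (s₀ 2)) = 0 := (or_iff_right hqQ).mp h1
    rw [Rat.num_div_den r] at h2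
    have := den_lt_denBound (torD_ne_zero hs₀) h2
    omega
  · have h1 := hb _ hG hcoef
    have h2 : ((torG P D r.num r.den K k).natDegree : ℝ) ≤ N := by
      exact_mod_cast natDegree_torG_le P D r.num r.den K hN k
    linarith

/-- integer coefficients are bounded by `2^{deg} · M` -/
theorem abs_coeff_le_two_pow_mul_mahlerMeasure (S : ℤ[X]) (k : ℕ) :
    ((|S.coeff k| : ℤ) : ℝ) ≤ 2 ^ S.natDegree * (S.map (Int.castRingHom ℂ)).mahlerMeasure := by
  have h1 := norm_coeff_le_choose_mul_mahlerMeasure k (S.map (Int.castRingHom ℂ))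
  rw [coeff_map, eq_intCast, Complex.norm_intCast] at h1
  rw [Int.cast_abs]
  refine h1.trans (mul_le_mul_of_nonneg_right ?_ (mahlerMeasure_nonneg _))
  have h2 : ((S.map (Int.castRingHom ℂ)).natDegree.choose k : ℝ) ≤
      2 ^ (S.map (Int.castRingHom ℂ)).natDegree := by exact_mod_cast Nat.choose_le_two_pow _ _
  exact h2.trans (pow_le_pow_right₀ (by norm_num) natDegree_map_le)

/-- `log H ≤ (5 + c_T) Q²` for `H = max 16 ⌈T⌉`, `log T ≤ c_T Q²`, `T ≥ 1` -/
theorem log_natHeight_le {T cT Q : ℝ} {Hn : ℕ} (hT1 : 1 ≤ T) (hQ1 : 1 ≤ Q) (_hcT : 0 ≤ cT)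
    (hlogT : Real.log T ≤ cT * Q ^ 2) (hHn : (Hn : ℝ) ≤ 16 + (T + 1)) (hHn16 : 16 ≤ Hn) :
    Real.log Hn ≤ (5 + cT) * Q ^ 2 := by
  have hHnpos : (0 : ℝ) < Hn := by exact_mod_cast (show 0 < Hn by omega)
  have h1 : (Hn : ℝ) ≤ 32 * T := by linarith
  have h2 : Real.log Hn ≤ Real.log 32 + Real.log T := by
    rw [← Real.log_mul (by norm_num) (by linarith)]
    exact Real.log_le_log hHnpos h1
  have h1Q : (1 : ℝ) ≤ Q ^ 2 := by nlinarith
  have h9 : Real.log 32 ≤ 5 * Q ^ 2 := by linarith [log_thirtytwo_le_five']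
  calc Real.log Hn ≤ Real.log 32 + Real.log T := h2
    _ ≤ 5 * Q ^ 2 + cT * Q ^ 2 := by linarith
    _ = (5 + cT) * Q ^ 2 := by ring

/-- roots of the norm polynomial are bounded: `b^q = z^{p}`, `‖z‖ ≤ Z`, `p ≤ a·q` ⇒ `‖b‖ ≤ exp(Z·a)`
(gen-13 helper extracted from the engine). -/
theorem norm_le_exp_of_pow_eq_pow {b z : ℂ} {q pn : ℕ} (hq : q ≠ 0) (hbz : b ^ q = z ^ pn)
    {Z a Q : ℝ} (hZ0 : 0 ≤ Z) (hz : ‖z‖ ≤ Z) (hQ : Q = q) (hpnQ : (pn : ℝ) ≤ a * Q) :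
    ‖b‖ ≤ Real.exp (Z * a) := by
  have hR0 : 0 ≤ Real.exp (Z * a) := (Real.exp_pos _).le
  have h1 : ‖b‖ ^ q = ‖z‖ ^ pn := by
    have := congrArg norm hbz
    rwa [norm_pow, norm_pow] at this
  have h2 : Z ^ pn ≤ Real.exp (Z * a) ^ q := by
    rw [← Real.exp_nat_mul]
    have h3 : Z ^ pn ≤ Real.exp Z ^ pn := pow_le_pow_left₀ hZ0 (self_le_exp' _) pn
    rw [← Real.exp_nat_mul] at h3
    refine h3.trans (Real.exp_le_exp.mpr ?_)
    rw [← hQ]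
    have h4 : (pn : ℝ) * Z ≤ (a * Q) * Z := mul_le_mul_of_nonneg_right hpnQ hZ0
    calc (pn : ℝ) * Z ≤ (a * Q) * Z := h4
      _ = Q * (Z * a) := by ring
  have h5 : ‖b‖ ^ q ≤ Real.exp (Z * a) ^ q :=
    h1 ▸ (pow_le_pow_left₀ (norm_nonneg _) hz pn).trans h2
  exact (pow_le_pow_iff_left₀ (norm_nonneg _) hR0 hq).mp h5

/-- `(e^{λ r})^q = (e^λ)^p` for `r = p/q` in lowest terms with `p ≥ 0` (gen-13 helper extracted from the
engine). -/
theorem cexp_mul_ratCast_pow (lam : ℂ) {r : ℚ} {pn : ℕ} (hpnZ : (pn : ℤ) = r.num) :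
    cexp (lam * ((r : ℝ) : ℂ)) ^ r.den = cexp lam ^ pn := by
  rw [← Complex.exp_nat_mul, ← Complex.exp_nat_mul]
  congr 1
  have e1 : ((r.den : ℕ) : ℂ) * ((r : ℝ) : ℂ) = (pn : ℂ) := by
    have h := Rat.den_mul_eq_num r
    have h' : ((r.den : ℚ) : ℂ) * ((r : ℚ) : ℂ) = ((r.num : ℚ) : ℂ) := by
      rw [← Rat.cast_mul, h]
    rw [Complex.ofReal_ratCast]
    rw [Rat.cast_natCast, Rat.cast_intCast] at h'
    rw [h', ← hpnZ, Int.cast_natCast]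
  calc ((r.den : ℕ) : ℂ) * (lam * ((r : ℝ) : ℂ)) = lam * (((r.den : ℕ) : ℂ) * ((r : ℝ) : ℂ)) := by
        ring
    _ = (pn : ℂ) * lam := by rw [e1, mul_comm]

/-- **(L) THE LOWER HALF OF THE ENGINE.**  The finite-transcendence-type inequality of `λ` (the body of
`FiniteTranscendenceType λ` with its constants `c, τ`) applied to the eliminant `S = resPoly E G N`:
`S ≠ 0` because no conjugate factor `conjFactor G b` (`E(b) = 0`) is the zero polynomial; `deg S ≤ nqK + 1 ≤ c_N Q`;
the Mahler-measure bookkeeping `M(S) ≤ (max 1 relLen G)^{deg E} M(E)^N`, `relLen G ≤ A_G Q^D`, `M(E) ≤ 2^n M_A^p`,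
`p ≤ a Q` gives `log H(S) ≤ c_H Q²` with `c_H = 5 + c_T`; hence `|S(λ)| ≥ exp(−A₃ Q^{2k})`, `A₃ = c (c_H + c_N)^k`
(`k ≥ τ`).  Pure bookkeeping; extracted verbatim from the gen-12 engine. -/
theorem engine_lower {lam : ℂ} {c : ℝ} {τ k : ℕ} (hc : 0 < c) (hτk : τ ≤ k)
    (hall : ∀ (S : ℤ[X]) (N H : ℕ), S ≠ 0 → 1 ≤ N → S.natDegree ≤ N → 16 ≤ H →
      (∀ i, |S.coeff i| ≤ (H : ℤ)) → Real.exp (-(c * ((N : ℝ) + Real.log H) ^ τ)) ≤ ‖aeval lam S‖)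
    {E : ℤ[X]} (hE0 : E ≠ 0) {n q pn K N D : ℕ} (hq : 0 < q) (hdegE : E.natDegree ≤ n * q)
    {MA lMA : ℝ} (hMA1 : 1 ≤ MA) (hlMA : lMA = Real.log MA)
    (hME : (E.map (Int.castRingHom ℂ)).mahlerMeasure ≤ 2 ^ n * MA ^ pn)
    {G : Fin (K + 1) → ℤ[X]} (hGN : ∀ i, (G i).natDegree ≤ N)
    (hfacne : ∀ b ∈ (E.map (Int.castRingHom ℂ)).roots, conjFactor G b ≠ 0)
    {Q AG a : ℝ} (hQ : Q = q) (hAG1 : 1 ≤ AG) (ha : 0 ≤ a) (hpnQ : (pn : ℝ) ≤ a * Q)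
    (hrelLen : relLen G ≤ AG * Q ^ D) {cN cT cH A₃ : ℝ} (hcN : cN = (n : ℝ) * K + 1)
    (hcT : cT = (n : ℝ) * K + n * AG + n * D + N * n + N * (a * lMA)) (hcH : cH = 5 + cT)
    (hA₃ : A₃ = c * (cH + cN) ^ k) :
    Real.exp (-(A₃ * Q ^ (2 * k))) ≤ ‖aeval lam (resPoly E G N)‖ := by
  classical
  obtain ⟨S, hSdef⟩ : ∃ S : ℤ[X], S = resPoly E G N := ⟨_, rfl⟩
  rw [← hSdef]
  have hS0 : S ≠ 0 := hSdef ▸ resPoly_ne_zero' E hE0 G hGN hfacne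
  have hQ1 : (1 : ℝ) ≤ Q := by rw [hQ]; exact_mod_cast hq
  have hQ0 : (0 : ℝ) < Q := by linarith
  have hnr0 : (0 : ℝ) ≤ n := Nat.cast_nonneg n
  have hK0 : (0 : ℝ) ≤ K := Nat.cast_nonneg K
  have hN0 : (0 : ℝ) ≤ N := Nat.cast_nonneg N
  have hD0 : (0 : ℝ) ≤ D := Nat.cast_nonneg D
  have hMA0 : 0 < MA := by linarith
  have hlMA0 : 0 ≤ lMA := hlMA ▸ Real.log_nonneg hMA1
  have hAG0 : 0 ≤ AG := by linarith
  have hAGpos : 0 < AG := by linarith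
  have hcN0 : 0 ≤ cN := by rw [hcN]; positivity
  have hcT0 : 0 ≤ cT := by rw [hcT]; positivity
  have hcH0 : 0 ≤ cH := by rw [hcH]; linarith
  -- degree
  obtain ⟨N₁, hN₁⟩ : ∃ N₁ : ℕ, N₁ = n * q * K + 1 := ⟨_, rfl⟩
  have hN₁1 : 1 ≤ N₁ := by omega
  have hdegS' : S.natDegree ≤ n * q * K := by
    rw [hSdef]
    exact (natDegree_resPoly_le E G hGN).trans (Nat.mul_le_mul_right _ hdegE)
  have hdegS : S.natDegree ≤ N₁ := hN₁ ▸ hdegS'.trans (Nat.le_succ _)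
  have hN₁Q : (N₁ : ℝ) ≤ cN * Q := by
    rw [hN₁, hcN]; push_cast; rw [← hQ]
    have : (n : ℝ) * K * 1 ≤ (n : ℝ) * K * Q := mul_le_mul_of_nonneg_left hQ1 (by positivity)
    linarith
  -- Mahler measure and height
  have hAQ1 : 1 ≤ AG * Q ^ D := one_le_mul_of_one_le_of_one_le hAG1 (one_le_pow₀ hQ1)
  have h2MA1 : 1 ≤ (2 : ℝ) ^ n * MA ^ pn :=
    one_le_mul_of_one_le_of_one_le (one_le_pow₀ (by norm_num)) (one_le_pow₀ hMA1)
  have hMS : (S.map (Int.castRingHom ℂ)).mahlerMeasure ≤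
      (AG * Q ^ D) ^ (n * q) * ((2 : ℝ) ^ n * MA ^ pn) ^ N := by
    have h1 := mahlerMeasure_resPoly_le E hE0 G hGN
    rw [← hSdef] at h1
    have h2 : relLen G ^ E.natDegree ≤ (AG * Q ^ D) ^ (n * q) :=
      calc relLen G ^ E.natDegree ≤ (max 1 (relLen G)) ^ E.natDegree :=
            pow_le_pow_left₀ (relLen_nonneg G) (le_max_right _ _) _
        _ ≤ (max 1 (relLen G)) ^ (n * q) := pow_le_pow_right₀ (le_max_left _ _) hdegE
        _ ≤ (AG * Q ^ D) ^ (n * q) :=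
            pow_le_pow_left₀ (by positivity) (max_le hAQ1 hrelLen) _
    have h3 : (E.map (Int.castRingHom ℂ)).mahlerMeasure ^ N ≤ ((2 : ℝ) ^ n * MA ^ pn) ^ N :=
      pow_le_pow_left₀ (mahlerMeasure_nonneg _) hME N
    exact h1.trans (mul_le_mul h2 h3 (pow_nonneg (mahlerMeasure_nonneg _) _) (by positivity))
  obtain ⟨T, hT⟩ : ∃ T : ℝ,
      T = 2 ^ (n * q * K) * ((AG * Q ^ D) ^ (n * q) * ((2 : ℝ) ^ n * MA ^ pn) ^ N) :=
    ⟨_, rfl⟩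
  have hT1 : 1 ≤ T := by
    rw [hT]
    exact one_le_mul_of_one_le_of_one_le (one_le_pow₀ (by norm_num))
      (one_le_mul_of_one_le_of_one_le (one_le_pow₀ hAQ1) (one_le_pow₀ h2MA1))
  have hT0 : 0 < T := by linarith
  obtain ⟨Hn, hHn⟩ : ∃ Hn : ℕ, Hn = max 16 ⌈T⌉₊ := ⟨_, rfl⟩
  have hHn16 : 16 ≤ Hn := hHn ▸ le_max_left _ _
  have hHnT : T ≤ (Hn : ℝ) := by
    rw [hHn]; push_cast
    exact (Nat.le_ceil T).trans (by exact_mod_cast le_max_right _ _)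
  have hHnle : (Hn : ℝ) ≤ 16 + (T + 1) := by
    rw [hHn]; push_cast
    refine max_le (by linarith) ?_
    linarith [Nat.ceil_lt_add_one (by linarith : (0 : ℝ) ≤ T)]
  have hcoefS : ∀ i, |S.coeff i| ≤ (Hn : ℤ) := by
    intro i
    have h1 := abs_coeff_le_two_pow_mul_mahlerMeasure S i
    have h2 : (2 : ℝ) ^ S.natDegree ≤ 2 ^ (n * q * K) := pow_le_pow_right₀ (by norm_num) hdegS'
    have h3 : ((|S.coeff i| : ℤ) : ℝ) ≤ T := by
      rw [hT]
      exact h1.trans (mul_le_mul h2 hMS (mahlerMeasure_nonneg _) (by positivity))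
    have h4 : ((|S.coeff i| : ℤ) : ℝ) ≤ ((Hn : ℤ) : ℝ) := by
      rw [Int.cast_natCast]; exact h3.trans hHnT
    exact_mod_cast h4
  have hlow := hall S N₁ Hn hS0 hN₁1 hdegS hHn16 hcoefS
  -- `log T ≤ c_T Q²`, `log H ≤ c_H Q²`, the exponent is at most `A₃ Q^{2k}`
  have hl2 : Real.log 2 ≤ 1 := by linarith [Real.log_two_lt_d9]
  have hlogQ : Real.log Q ≤ Q := log_le_self_of_pos' hQ0
  have hlogAG : Real.log AG ≤ AG := log_le_self_of_pos' hAGpos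
  have hQQ : Q ≤ Q ^ 2 := by nlinarith
  have hlogT : Real.log T ≤ cT * Q ^ 2 := by
    have hAQ0 : 0 < AG * Q ^ D := by positivity
    have h2MA0 : 0 < (2 : ℝ) ^ n * MA ^ pn := by positivity
    have e1 : Real.log T = (n * q * K : ℕ) * Real.log 2 +
        ((n * q : ℕ) * (Real.log AG + D * Real.log Q) + N * (n * Real.log 2 + pn * lMA)) := by
      rw [hT, Real.log_mul (by positivity) (by positivity), Real.log_pow,
        Real.log_mul (by positivity) (by positivity), Real.log_pow, Real.log_pow,
        Real.log_mul (by positivity) (by positivity), Real.log_pow,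
        Real.log_mul (by positivity) (by positivity), Real.log_pow, Real.log_pow, hlMA]
    rw [e1]; push_cast; rw [← hQ]
    have t1 : (n : ℝ) * Q * K * Real.log 2 ≤ n * K * Q ^ 2 := by
      have b1 : (n : ℝ) * Q * K * Real.log 2 ≤ n * Q * K * 1 :=
        mul_le_mul_of_nonneg_left hl2 (by positivity)
      have b2 : (n : ℝ) * K * Q ≤ n * K * Q ^ 2 :=
        mul_le_mul_of_nonneg_left hQQ (by positivity)
      linarith
    have t2 : (n : ℝ) * Q * (Real.log AG + D * Real.log Q) ≤ n * AG * Q ^ 2 + n * D * Q ^ 2 := by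
      have a1 : Real.log AG + D * Real.log Q ≤ AG + D * Q := by
        have := mul_le_mul_of_nonneg_left hlogQ hD0; linarith
      have a2 : (n : ℝ) * Q * (Real.log AG + D * Real.log Q) ≤ n * Q * (AG + D * Q) :=
        mul_le_mul_of_nonneg_left a1 (by positivity)
      have a3 : (n : ℝ) * AG * Q ≤ n * AG * Q ^ 2 :=
        mul_le_mul_of_nonneg_left hQQ (by positivity : (0 : ℝ) ≤ n * AG)
      linarith
    have t3 : (N : ℝ) * (n * Real.log 2 + pn * lMA) ≤ N * n * Q ^ 2 + N * (a * lMA) * Q ^ 2 := by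
      have a1 : (n : ℝ) * Real.log 2 ≤ n * Q ^ 2 := by
        have b1 := mul_le_mul_of_nonneg_left hl2 hnr0
        have b2 : (n : ℝ) * 1 ≤ n * Q ^ 2 := mul_le_mul_of_nonneg_left (one_le_pow₀ hQ1) hnr0
        linarith
      have a2 : (pn : ℝ) * lMA ≤ a * Q * lMA := mul_le_mul_of_nonneg_right hpnQ hlMA0
      have a3 : a * lMA * Q ≤ a * lMA * Q ^ 2 :=
        mul_le_mul_of_nonneg_left hQQ (by positivity : (0 : ℝ) ≤ a * lMA)
      have a4 : (N : ℝ) * (n * Real.log 2 + pn * lMA) ≤ N * (n * Q ^ 2 + a * lMA * Q ^ 2) :=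
        mul_le_mul_of_nonneg_left (by linarith) hN0
      linarith
    rw [hcT]; linarith
  have hlogH : Real.log Hn ≤ cH * Q ^ 2 :=
    hcH ▸ log_natHeight_le hT1 hQ1 hcT0 hlogT hHnle hHn16
  have hH16r : (16 : ℝ) ≤ Hn := by exact_mod_cast hHn16
  have hlogH0 : 0 ≤ Real.log Hn := Real.log_nonneg (by linarith)
  have hN₁r1 : (1 : ℝ) ≤ N₁ := by exact_mod_cast hN₁1
  have hexp : c * ((N₁ : ℝ) + Real.log Hn) ^ τ ≤ A₃ * Q ^ (2 * k) := by
    rw [hA₃]; exact type_exponent_le hc.le hQ1 hN₁r1 hN₁Q hlogH0 hlogH hcN0 hcH0 hτk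
  exact le_trans (Real.exp_le_exp.mpr (by linarith)) hlow

/-- **(U) THE UPPER HALF OF THE ENGINE.**  `S(λ) = lc(E)^N ∏_{E(b)=0} F_b(λ)` (`aeval_resPoly`); with the
special factor (at the root `w`) at most `Q^D Kl η`, the other factors at most `Q^D B'` (at most `nq` of them),
and `|lc(E)| ≤ M(E) ≤ 2^n M_A^p ≤ exp(n + log M_A · a Q)`, one gets `|S(λ)| ≤ exp(A₁ Q²) η` with
`A₁ = (2D + B' + Kl + 1) n² + c_L`, `c_L = N (n + log M_A · a)`.  Extracted verbatim from the gen-12 engine. -/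
theorem engine_upper {lam : ℂ} {E : ℤ[X]} {n q pn K N D : ℕ} (hn1 : 1 ≤ n) (hq : 0 < q)
    (hdegE : E.natDegree ≤ n * q) {MA lMA : ℝ} (hMA1 : 1 ≤ MA) (hlMA : lMA = Real.log MA)
    (hME : (E.map (Int.castRingHom ℂ)).mahlerMeasure ≤ 2 ^ n * MA ^ pn)
    {G : Fin (K + 1) → ℤ[X]} (hGN : ∀ i, (G i).natDegree ≤ N)
    {Q a B' Kl η : ℝ} (hQ : Q = q) (ha : 0 ≤ a) (hpnQ : (pn : ℝ) ≤ a * Q) (hB'1 : 1 ≤ B')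
    (hKl0 : 0 ≤ Kl) (hη0 : 0 ≤ η) {w : ℂ} (hwmem : w ∈ (E.map (Int.castRingHom ℂ)).roots)
    (hwfac : ‖(conjFactor G w).eval lam‖ ≤ Q ^ D * (Kl * η))
    (hofac : ∀ b ∈ (E.map (Int.castRingHom ℂ)).roots, ‖(conjFactor G b).eval lam‖ ≤ Q ^ D * B')
    {cL A₁ : ℝ} (hcL : cL = (N : ℝ) * (n + lMA * a))
    (hA₁ : A₁ = (2 * D + B' + Kl + 1) * (n : ℝ) ^ 2 + cL) :
    ‖aeval lam (resPoly E G N)‖ ≤ Real.exp (A₁ * Q ^ 2) * η := by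
  classical
  have hQ1 : (1 : ℝ) ≤ Q := by rw [hQ]; exact_mod_cast hq
  have hQ0 : (0 : ℝ) < Q := by linarith
  have hnr1 : (1 : ℝ) ≤ n := by exact_mod_cast hn1
  have hnr0 : (0 : ℝ) ≤ n := by linarith
  have hN0 : (0 : ℝ) ≤ N := Nat.cast_nonneg N
  have hMA0 : 0 < MA := by linarith
  have hlMA0 : 0 ≤ lMA := hlMA ▸ Real.log_nonneg hMA1
  have hMAexp : MA = Real.exp lMA := by rw [hlMA, Real.exp_log hMA0]
  have hcL0 : 0 ≤ cL := by rw [hcL]; positivity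
  have hcard : Multiset.card (E.map (Int.castRingHom ℂ)).roots ≤ n * q :=
    (card_roots' _).trans (natDegree_map_le.trans hdegE)
  have hval : aeval lam (resPoly E G N) = (E.map (Int.castRingHom ℂ)).leadingCoeff ^ N *
      (((E.map (Int.castRingHom ℂ)).roots).map fun b => (conjFactor G b).eval lam).prod :=
    aeval_resPoly E G hGN lam
  have hQB1 : 1 ≤ Q ^ D * B' := one_le_mul_of_one_le_of_one_le (one_le_pow₀ hQ1) hB'1
  -- the leading coefficient of `E`
  have hlcE : ‖(E.map (Int.castRingHom ℂ)).leadingCoeff ^ N‖ ≤ Real.exp (cL * Q) := by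
    rw [norm_pow]
    have h1 : ‖(E.map (Int.castRingHom ℂ)).leadingCoeff‖ ≤ 2 ^ n * MA ^ pn :=
      (leadingCoeff_le_mahlerMeasure _).trans hME
    have h2 : (2 : ℝ) ^ n * MA ^ pn ≤ Real.exp (n + lMA * (a * Q)) := by
      rw [Real.exp_add]
      refine mul_le_mul ?_ ?_ (by positivity) (Real.exp_pos _).le
      · have a1 : (2 : ℝ) ≤ Real.exp 1 := by have := Real.add_one_le_exp (1 : ℝ); linarith
        calc (2 : ℝ) ^ n ≤ (Real.exp 1) ^ n := pow_le_pow_left₀ (by norm_num) a1 n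
          _ = Real.exp (n * 1) := by rw [← Real.exp_nat_mul]
          _ = Real.exp n := by rw [mul_one]
      · rw [hMAexp, ← Real.exp_nat_mul]
        refine Real.exp_le_exp.mpr ?_
        calc (pn : ℝ) * lMA ≤ (a * Q) * lMA := mul_le_mul_of_nonneg_right hpnQ hlMA0
          _ = lMA * (a * Q) := by ring
    have h3 : ‖(E.map (Int.castRingHom ℂ)).leadingCoeff‖ ^ N ≤
        Real.exp (n + lMA * (a * Q)) ^ N :=
      pow_le_pow_left₀ (norm_nonneg _) (h1.trans h2) N
    refine h3.trans ?_
    rw [← Real.exp_nat_mul]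
    refine Real.exp_le_exp.mpr ?_
    rw [hcL]
    have : (N : ℝ) * n * 1 ≤ (N : ℝ) * n * Q := mul_le_mul_of_nonneg_left hQ1 (by positivity)
    nlinarith [mul_nonneg hN0 (mul_nonneg hlMA0 (mul_nonneg ha hQ0.le))]
  have hup : ‖aeval lam (resPoly E G N)‖ ≤
      Real.exp (cL * Q) * ((Q ^ D * B') ^ (n * q) * (Q ^ D * (Kl * η))) := by
    rw [hval, norm_mul]
    refine mul_le_mul hlcE ?_ (norm_nonneg _) (Real.exp_pos _).le
    rw [← Multiset.cons_erase hwmem, Multiset.map_cons, Multiset.prod_cons, norm_mul, mul_comm]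
    refine mul_le_mul ?_ hwfac (norm_nonneg _) (by positivity)
    refine (norm_multiset_map_prod_le _ (by positivity) _ fun b hb =>
      hofac b (Multiset.mem_of_mem_erase hb)).trans ?_
    refine pow_le_pow_right₀ hQB1 ?_
    exact (Multiset.card_erase_le).trans hcard
  -- at most `exp(A₁ Q²) η`
  obtain ⟨Q', hQ'⟩ : ∃ Q' : ℝ, Q' = (n : ℝ) * Q := ⟨_, rfl⟩
  have hQQ' : Q ≤ Q' := by rw [hQ']; exact le_mul_of_one_le_left hQ0.le hnr1
  have hQ'1 : 1 ≤ Q' := hQ1.trans hQQ'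
  have hQ'n : ((n * q : ℕ) : ℝ) = Q' := by rw [hQ', hQ]; push_cast; ring
  have hup' : (Q ^ D * B') ^ (n * q) * (Q ^ D * (Kl * η)) ≤
      Real.exp ((2 * D + B' + Kl + 1) * Q' ^ 2) * η := by
    have hQD : Q ^ D ≤ Q' ^ D := pow_le_pow_left₀ hQ0.le hQQ' D
    have h1 : Q ^ D * B' ≤ Q' ^ D * B' := mul_le_mul_of_nonneg_right hQD (by linarith)
    have h2 : Q ^ D * (Kl * η) ≤ Q' ^ D * (Kl * η) :=
      mul_le_mul_of_nonneg_right hQD (by positivity)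
    calc (Q ^ D * B') ^ (n * q) * (Q ^ D * (Kl * η))
        ≤ (Q' ^ D * B') ^ (n * q) * (Q' ^ D * (Kl * η)) :=
          mul_le_mul (pow_le_pow_left₀ (by positivity) h1 _) h2 (by positivity) (by positivity)
      _ ≤ Real.exp ((2 * D + B' + Kl + 1) * Q' ^ 2) * η := upper_exp hQ'n hQ'1 hB'1 hKl0 hη0
  have hQQ : Q ≤ Q ^ 2 := by nlinarith
  have hA₁Q : cL * Q + (2 * D + B' + Kl + 1) * Q' ^ 2 ≤ A₁ * Q ^ 2 := by
    rw [hA₁, hQ']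
    have : cL * Q ≤ cL * Q ^ 2 := mul_le_mul_of_nonneg_left hQQ hcL0
    linarith
  calc ‖aeval lam (resPoly E G N)‖
      ≤ Real.exp (cL * Q) * ((Q ^ D * B') ^ (n * q) * (Q ^ D * (Kl * η))) := hup
    _ ≤ Real.exp (cL * Q) * (Real.exp ((2 * D + B' + Kl + 1) * Q' ^ 2) * η) :=
        mul_le_mul_of_nonneg_left hup' (Real.exp_pos _).le
    _ = Real.exp (cL * Q + (2 * D + B' + Kl + 1) * Q' ^ 2) * η := by rw [Real.exp_add, mul_assoc]
    _ ≤ Real.exp (A₁ * Q ^ 2) * η :=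
        mul_le_mul_of_nonneg_right (Real.exp_le_exp.mpr hA₁Q) hη0

end Summit.Schanuel.Schanuel.Theorems.RootDecomp1KKummerClosure
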